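import Summits.HodgeConjecture.HodgeConjecture.Theorems.R90S6EtaOnePartnerOnGenerators -- ★ TE-gen (p06, p863893): (N.1′) `etaOneGraphPartnerAlgHom_heckeDiag_one_eq_basic`, (N.2) `_heckeDiag_two`, (N.3) `_three`, (N.3′) `_three_inv` (brings ★ W10 `etaOneGraphPartnerAlgHom`, ★ W10-c (G.1)–(G.3))
import Summits.HodgeConjecture.HodgeConjecture.Theorems.R90S6GLThreePieriClosed      -- ★ (H.1)(H.2) CLOSED Pieri (p06, p864298): `doubleCosetOperator_zpowDiagGL_mul_heckeDiag_one_three_of_antitone` ∕ `_two_three_of_antitone`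
import Summits.HodgeConjecture.HodgeConjecture.Theorems.R90S6MacdonaldRankOneU2      -- ★ F2-U2 (p03): `eq_basic_two` (brings ★ `heckeEigencharacter_doubleCosetOperator_basic_two`, ★ `sqrt_card_residueField_mul_self`)
import HarnessLib

/-!
# R90 · S6 «Ch. 14.1–14.5 stable trace formula» — card TE5 (row E1.4.4.3.1, closed coefficients — recursion form): THE `η̂₁`-IMAGE OF ★ PIERI — the recursion for the
# `η̂₁ c_μ` on the `U(1,1)` side, with its `hQ`-free seeds (`Theorems/R90S6EtaOnePartnerClosedForm.lean`)

Cell `hodgecm-mathlib`, crux H413 (`stmt-HodgeConjecture-24833`), route of record `HCCMUnconditional`; programme R90-TF (brief `director/R90-BRIEF.v2.md`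
1f40d54518340a35), section S6 (base `R90-C14`, dealer R90-C14-plan (g2)), seat R90-C14-p04 (g2); CARD TE5 pre-dealt BY NAME 2026-09-05T02:20:02Z (R90 bus), census
02:20:39Z («no ★ `GL₃` closed form ⇒ RECURSION FORM»), HEADS 02:21:24Z, corrected at GREEN 02:29:25Z (the seeds (N.1)–(N.3′) are ★ TE-gen p06 — cited, not restated).  Lane `--kind proof --supports stmt-HodgeConjecture-24833 --as helper`; THEOREMS ONLY over ★ carriers
(no definition, no instance, no notation, no named fact, no kit, no `sorry`).

## Content — the `η̂₁`-IMAGE OF ★ PIERI: the recursion for the `η̂₁ c_μ` on the `U(1,1)` side, with its seeds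

`η̂₁ : ℋ(GL₃(K), GL₃(𝒪)) →ₐ[ℂ] ℋ(U(J₀,2)(E_w), K₀)` is ★ `etaOneGraphPartnerAlgHom` [Rogawski1990, §4.10 p. 57] (graph `λ^{U(J₀,2)}_{(z,1)}(η̂₁ φ) =
λ^{GL₃}_{(z,1,z⁻¹)}(φ)`).  Its values on the generators `T₁, T₂, T₃, T₃⁻¹` of `ℋ(GL₃) = ℂ[T₁, T₂, T₃^{±1}]` are ★ (N.1′)(N.2)(N.3)(N.3′) of ★ TE-gen
`R90S6EtaOnePartnerOnGenerators` (p06): `η̂₁ T₁ = √Q • φ′₁ + √Q • 1 = η̂₁ T₂`, `η̂₁ T₃ = η̂₁ T₃⁻¹ = 1` (`φ′₁ = 1_{K₀ t K₀}` the basic operator of `U(1,1)`,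
`Q = #𝓀[E_w]`, `√Q = Nat.sqrt Q = q_v`), under the junction identity `hqQ : (#𝓀[K] : ℂ) = #𝓀[E_w]` and the square identity `hQ : √Q·√Q = Q`.  This file:

* (E5.1) `etaOneGraphPartnerAlgHom_heckeDiag_one_eq_sqrt_smul` ∕ (E5.2) `_heckeDiag_two_eq_sqrt_smul`: ★ (N.1′) ∕ (N.2) in the letters of ★ TE4
  `etaOneGraphPartner_eq_sum_smul_doubleCosetOperator_pow` — for ANY `t` with matrix `diag(ϖ_w, ϖ_w⁻¹)` (★ `eq_basic_two`) and WITHOUT the `hQ` binder (discharged by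
  ★ `sqrt_card_residueField_mul_self`: the residue cardinality at an inert place is a square);
* (E5.3) `etaOneGraphPartnerAlgHom_mul_heckeDiag_one` ∕ (E5.3′) `_mul_heckeDiag_two`: **`η̂₁ (x · T_r) = η̂₁ x · (√Q • φ′₁ + √Q • 1)`** (`r = 1, 2`) for every
  `x ∈ ℋ(GL₃)` — the letter that transports any product identity;
* (E5.4) `sum_pieri_one_smul_etaOneGraphPartnerAlgHom` ∕ (E5.4′) `sum_pieri_two_smul_etaOneGraphPartnerAlgHom` — **THE RECURSION**: for antitone `μ`,
  `Σ_{i : μ + e_i antitone} N₁(μ, μ + e_i) • η̂₁ c_{μ + e_i} = η̂₁ c_μ · (√Q • φ′₁ + √Q • 1)` and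
  `Σ_{i : μ + 𝟙 − e_i antitone} N₂(μ, μ + 𝟙 − e_i) • η̂₁ c_{μ + 𝟙 − e_i} = η̂₁ c_μ · (√Q • φ′₁ + √Q • 1)` — the `η̂₁`-images of ★ (H.1)(H.2) CLOSED Pieri
  `doubleCosetOperator_zpowDiagGL_mul_heckeDiag_one_three_of_antitone` ∕ `_two_three_of_antitone` (`N_r` = their orbit-count coefficients, VERBATIM at `k = ℂ`).
  Seeded by `η̂₁ c_0 = η̂₁ 1 = 1` (★ `etaOneGraphPartnerAlgHom_one`) and `η̂₁ c_{(1,1,1)} = η̂₁ T₃ = 1`, `η̂₁ T₃⁻¹ = 1` (★ (N.3)(N.3′)), these determine every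
  `η̂₁ c_μ` as a polynomial in `φ′₁` — the RECURSION FORM of the closed coefficients of row E1.4.4.3.1 (no Hall–Littlewood closed form for `𝒮^{GL₃}(c_μ)` is ★,
  census 02:20:39Z; the `φ′₁^j ↦ φ′_k` conversion is ★ TE4 ∕ ★ W8-g).

HONEST LABEL: HC_CM is proved only modulo the 7 printed citations (2 remaining named inputs: hLiu418 = `stmt-HodgeConjecture-24832`, h413 =
`stmt-HodgeConjecture-24833`) until rung 0 closes; REL ≠ ★ ≠ BUILT.  This file is ★-grade bookkeeping over ★ TE-gen ∕ ★ (H.1)(H.2) ∕ ★ F2-U2; it discharges no named input.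

## References
* [Rogawski1990] J. D. Rogawski, *Automorphic Representations of Unitary Groups in Three Variables*, Ann. of Math. Stud. 123 (1990), §4.5 p. 50, §4.10
  Prop. 4.10.1 (b), Prop. 4.10.2 pp. 57–58.
* [CartierCorvallis1979] P. Cartier, *Representations of 𝔭-adic groups: a survey*, PSPM 33.1 (1979), §IV (4.2), Thm. 4.1, Cor. 4.2.
* [ShimuraIATAF1971] G. Shimura, *Introduction to the arithmetic theory of automorphic functions* (1971), Thm. 3.21.
* [Macdonald1995] I. G. Macdonald, *Symmetric functions and Hall polynomials*, 2nd ed. (1995), Ch. II (4.6), Ch. V (2.6) (Pieri for `ℋ(GL_n)`).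
-/

set_option autoImplicit false
-- the mandated namespace repeats the single-problem summit's segment (`HodgeConjecture.HodgeConjecture`)
set_option linter.dupNamespace false

noncomputable section

open NumberField IsDedekindDomain
open Literature.NumberTheory.Automorphic Literature.NumberTheory.Automorphic.HermitianLattice Literature.NumberTheory.Automorphic.UnitaryGroup
open Literature.NumberTheory.Automorphic.CartanUnique
open scoped MatrixGroups
open ValuativeRel

namespace Summit.HodgeConjecture.HodgeConjecture.R90.S6

universe u

/-- Pure algebra: `f (x · y) = f x · e` once `f y = e` (over light carriers, so that at the Hecke algebras only unification is needed). [folklore] -/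
private theorem algHom_apply_mul_eq_of_apply_eq {A B : Type*} [Semiring A] [Semiring B] [Algebra ℂ A] [Algebra ℂ B] (f : A →ₐ[ℂ] B)
    (x : A) {y : A} {e : B} (hy : f y = e) : f (x * y) = f x * e := by
  rw [map_mul, hy]

/-- Pure algebra: `f (Σ_{i ∈ s} a_i • x_i) = Σ_{i ∈ s} a_i • f x_i` (over light carriers). [folklore] -/
private theorem algHom_apply_sum_smul_etaOne {A B ι : Type*} [Semiring A] [Semiring B] [Algebra ℂ A] [Algebra ℂ B] (f : A →ₐ[ℂ] B)
    (s : Finset ι) (a : ι → ℂ) (x : ι → A) : f (∑ i ∈ s, a i • x i) = ∑ i ∈ s, a i • f (x i) := by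
  simp only [map_sum, map_smul]

section Partner

variable {F E : Type} [Field F] [NumberField F] [Field E] [NumberField E] [Algebra F E] [Algebra.IsQuadraticExtension F E]
  (c : E ≃ₐ[F] E) (hc1 : c ≠ 1) (v : HeightOneSpectrum (𝓞 F)) (w : PlacesOver E v) (hw : c • w.1 = w.1)
  (hv : Algebra.IsUnramifiedIn (𝓞 E) v.asIdeal)
  {K : Type u} [Field K] [ValuativeRel K] [IsDiscreteValuationRing 𝒪[K]] [Finite 𝓀[K]] {ϖ : K}
  [IsHeckeTriple (⊤ : Submonoid (GL (Fin 3) K)) (glInt 3 K) (glInt 3 K)]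
  (hϖ : IsUniformizingElement ϖ) {u : ℂˣ} (hu : (u : ℂ) ^ 2 = ((Nat.card 𝓀[K] : ℕ) : ℂ))
  {wt : Multiplicative (Fin 3 → ℤ) →* ℂ}
  (hwt : ∀ e : Fin 3 → ℤ, wt (Multiplicative.ofAdd e) = ((u ^ ((((3 : ℕ) : ℤ) - 1) * (∑ i, e i) - 2 * satakeTwistExp e) : ℂˣ) : ℂ))

/-! ## §1 The seeds in the letters of ★ TE4 (`hQ` discharged) -/

/-- **(E5.1) `η̂₁ T₁ = √Q • φ′₁ + √Q • 1`** for ANY `t ∈ U(J₀,2)(E_w)` with matrix `diag(ϖ_w, ϖ_w⁻¹)` (★ `eq_basic_two`: such a `t` IS the basic element of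
★ `UnitaryRankOneBasicHeckeOperator`), `φ′₁ = 1_{K₀ t K₀}`, `√Q = Nat.sqrt #𝓀[E_w]`, under the junction identity `hqQ : (#𝓀[K] : ℂ) = #𝓀[E_w]` — ★ (N.1′)
`etaOneGraphPartnerAlgHom_heckeDiag_one_eq_basic` with its square binder `hQ : √Q·√Q = Q` DISCHARGED (★ `sqrt_card_residueField_mul_self` through any unramified datum `hd`,
`σ_w ≠ id` by ★ `exists_galAdicCompletionMap_ne`).  [cite: Rogawski1990, §4.10 Prop. 4.10.1 (b), Prop. 4.10.2 pp. 57–58] [cite: CartierCorvallis1979, §IV (4.2), Cor. 4.2] -/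
theorem etaOneGraphPartnerAlgHom_heckeDiag_one_eq_sqrt_smul {ϖ' : w.1.adicCompletion E}
    (hd : UnramifiedLocalConjDatum (galAdicCompletionMap (L := E) c hw) ϖ')
    (t : unitaryGroupOfForm (galAdicCompletionMap (L := E) c hw) ((StdForm.antidiagonal 2).over (w.1.adicCompletion E)))
    (ht : (t : GL (Fin 2) (w.1.adicCompletion E)) = zpowDiagGL (uniformizer_ne_zero hd.vϖ) ![(1 : ℤ), -1])
    (hqQ : ((Nat.card 𝓀[K] : ℕ) : ℂ) = (Nat.card (Valued.ResidueField (w.1.adicCompletion E)) : ℂ)) :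
    haveI := isHeckeTriple_unitaryInt_adicCompletion c v w hw ((StdForm.antidiagonal 2).over (w.1.adicCompletion E))
    etaOneGraphPartnerAlgHom c hc1 v w hw hv hϖ hu hwt
        (heckeAlgebra.doubleCosetOperator (glInt 3 K) (heckeDiag 3 (Units.mk0 ϖ hϖ.ne_zero) 1)) =
      ((Nat.sqrt (Nat.card (Valued.ResidueField (w.1.adicCompletion E))) : ℕ) : ℂ) •
            heckeAlgebra.doubleCosetOperator
              (unitaryInt (galAdicCompletionMap (L := E) c hw) ((StdForm.antidiagonal 2).over (w.1.adicCompletion E))) t +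
          ((Nat.sqrt (Nat.card (Valued.ResidueField (w.1.adicCompletion E))) : ℕ) : ℂ) • 1 := by
  haveI := isHeckeTriple_unitaryInt_adicCompletion c v w hw ((StdForm.antidiagonal 2).over (w.1.adicCompletion E))
  haveI := finite_residueField_adicCompletion E w.1
  have hQ : ((Nat.sqrt (Nat.card (Valued.ResidueField (w.1.adicCompletion E))) : ℕ) : ℂ) *
      ((Nat.sqrt (Nat.card (Valued.ResidueField (w.1.adicCompletion E))) : ℕ) : ℂ) =
        (Nat.card (Valued.ResidueField (w.1.adicCompletion E)) : ℂ) := by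
    exact_mod_cast hd.sqrt_card_residueField_mul_self (exists_galAdicCompletionMap_ne c hc1 v w hw)
  rw [eq_basic_two hd t ht]
  exact etaOneGraphPartnerAlgHom_heckeDiag_one_eq_basic c hc1 v w hw hv hϖ hu hwt hd hqQ hQ

/-- **(E5.2) `η̂₁ T₂ = √Q • φ′₁ + √Q • 1`** (★ (N.2) `η̂₁ T₂ = η̂₁ T₁` and (E5.1)). [cite: Rogawski1990, §4.10 Prop. 4.10.2 p. 58] -/
theorem etaOneGraphPartnerAlgHom_heckeDiag_two_eq_sqrt_smul {ϖ' : w.1.adicCompletion E}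
    (hd : UnramifiedLocalConjDatum (galAdicCompletionMap (L := E) c hw) ϖ')
    (t : unitaryGroupOfForm (galAdicCompletionMap (L := E) c hw) ((StdForm.antidiagonal 2).over (w.1.adicCompletion E)))
    (ht : (t : GL (Fin 2) (w.1.adicCompletion E)) = zpowDiagGL (uniformizer_ne_zero hd.vϖ) ![(1 : ℤ), -1])
    (hqQ : ((Nat.card 𝓀[K] : ℕ) : ℂ) = (Nat.card (Valued.ResidueField (w.1.adicCompletion E)) : ℂ)) :
    haveI := isHeckeTriple_unitaryInt_adicCompletion c v w hw ((StdForm.antidiagonal 2).over (w.1.adicCompletion E))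
    etaOneGraphPartnerAlgHom c hc1 v w hw hv hϖ hu hwt
        (heckeAlgebra.doubleCosetOperator (glInt 3 K) (heckeDiag 3 (Units.mk0 ϖ hϖ.ne_zero) 2)) =
      ((Nat.sqrt (Nat.card (Valued.ResidueField (w.1.adicCompletion E))) : ℕ) : ℂ) •
            heckeAlgebra.doubleCosetOperator
              (unitaryInt (galAdicCompletionMap (L := E) c hw) ((StdForm.antidiagonal 2).over (w.1.adicCompletion E))) t +
          ((Nat.sqrt (Nat.card (Valued.ResidueField (w.1.adicCompletion E))) : ℕ) : ℂ) • 1 :=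
  haveI := isHeckeTriple_unitaryInt_adicCompletion c v w hw ((StdForm.antidiagonal 2).over (w.1.adicCompletion E))
  (etaOneGraphPartnerAlgHom_heckeDiag_two c hc1 v w hw hv hϖ hu hwt).trans
    (etaOneGraphPartnerAlgHom_heckeDiag_one_eq_sqrt_smul c hc1 v w hw hv hϖ hu hwt hd t ht hqQ)

/-! ## §2 The product letters -/

/-- **(E5.3) `η̂₁ (x · T₁) = η̂₁ x · (√Q • φ′₁ + √Q • 1)`** for every `x ∈ ℋ(GL₃(K), GL₃(𝒪))` (`η̂₁` is multiplicative, (E5.1)) — the letter that transports any product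
identity `x · T₁ = …` to the `U(1,1)` side. [cite: Rogawski1990, §4.10 Prop. 4.10.1 (b) p. 58] -/
theorem etaOneGraphPartnerAlgHom_mul_heckeDiag_one {ϖ' : w.1.adicCompletion E}
    (hd : UnramifiedLocalConjDatum (galAdicCompletionMap (L := E) c hw) ϖ')
    (t : unitaryGroupOfForm (galAdicCompletionMap (L := E) c hw) ((StdForm.antidiagonal 2).over (w.1.adicCompletion E)))
    (ht : (t : GL (Fin 2) (w.1.adicCompletion E)) = zpowDiagGL (uniformizer_ne_zero hd.vϖ) ![(1 : ℤ), -1])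
    (hqQ : ((Nat.card 𝓀[K] : ℕ) : ℂ) = (Nat.card (Valued.ResidueField (w.1.adicCompletion E)) : ℂ))
    (x : heckeAlgebra ℂ (GL (Fin 3) K) (glInt 3 K)) :
    haveI := isHeckeTriple_unitaryInt_adicCompletion c v w hw ((StdForm.antidiagonal 2).over (w.1.adicCompletion E))
    etaOneGraphPartnerAlgHom c hc1 v w hw hv hϖ hu hwt
        (x * heckeAlgebra.doubleCosetOperator (glInt 3 K) (heckeDiag 3 (Units.mk0 ϖ hϖ.ne_zero) 1)) =
      etaOneGraphPartnerAlgHom c hc1 v w hw hv hϖ hu hwt x *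
        (((Nat.sqrt (Nat.card (Valued.ResidueField (w.1.adicCompletion E))) : ℕ) : ℂ) •
            heckeAlgebra.doubleCosetOperator
              (unitaryInt (galAdicCompletionMap (L := E) c hw) ((StdForm.antidiagonal 2).over (w.1.adicCompletion E))) t +
          ((Nat.sqrt (Nat.card (Valued.ResidueField (w.1.adicCompletion E))) : ℕ) : ℂ) • 1) :=
  haveI := isHeckeTriple_unitaryInt_adicCompletion c v w hw ((StdForm.antidiagonal 2).over (w.1.adicCompletion E))
  algHom_apply_mul_eq_of_apply_eq _ x (etaOneGraphPartnerAlgHom_heckeDiag_one_eq_sqrt_smul c hc1 v w hw hv hϖ hu hwt hd t ht hqQ)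

/-- **(E5.3′) `η̂₁ (x · T₂) = η̂₁ x · (√Q • φ′₁ + √Q • 1)`** for every `x ∈ ℋ(GL₃(K), GL₃(𝒪))` ((E5.2)). [cite: Rogawski1990, §4.10 Prop. 4.10.1 (b) p. 58] -/
theorem etaOneGraphPartnerAlgHom_mul_heckeDiag_two {ϖ' : w.1.adicCompletion E}
    (hd : UnramifiedLocalConjDatum (galAdicCompletionMap (L := E) c hw) ϖ')
    (t : unitaryGroupOfForm (galAdicCompletionMap (L := E) c hw) ((StdForm.antidiagonal 2).over (w.1.adicCompletion E)))
    (ht : (t : GL (Fin 2) (w.1.adicCompletion E)) = zpowDiagGL (uniformizer_ne_zero hd.vϖ) ![(1 : ℤ), -1])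
    (hqQ : ((Nat.card 𝓀[K] : ℕ) : ℂ) = (Nat.card (Valued.ResidueField (w.1.adicCompletion E)) : ℂ))
    (x : heckeAlgebra ℂ (GL (Fin 3) K) (glInt 3 K)) :
    haveI := isHeckeTriple_unitaryInt_adicCompletion c v w hw ((StdForm.antidiagonal 2).over (w.1.adicCompletion E))
    etaOneGraphPartnerAlgHom c hc1 v w hw hv hϖ hu hwt
        (x * heckeAlgebra.doubleCosetOperator (glInt 3 K) (heckeDiag 3 (Units.mk0 ϖ hϖ.ne_zero) 2)) =
      etaOneGraphPartnerAlgHom c hc1 v w hw hv hϖ hu hwt x *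
        (((Nat.sqrt (Nat.card (Valued.ResidueField (w.1.adicCompletion E))) : ℕ) : ℂ) •
            heckeAlgebra.doubleCosetOperator
              (unitaryInt (galAdicCompletionMap (L := E) c hw) ((StdForm.antidiagonal 2).over (w.1.adicCompletion E))) t +
          ((Nat.sqrt (Nat.card (Valued.ResidueField (w.1.adicCompletion E))) : ℕ) : ℂ) • 1) :=
  haveI := isHeckeTriple_unitaryInt_adicCompletion c v w hw ((StdForm.antidiagonal 2).over (w.1.adicCompletion E))
  algHom_apply_mul_eq_of_apply_eq _ x (etaOneGraphPartnerAlgHom_heckeDiag_two_eq_sqrt_smul c hc1 v w hw hv hϖ hu hwt hd t ht hqQ)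

/-! ## §3 THE RECURSION: the `η̂₁`-images of ★ (H.1)(H.2) CLOSED Pieri -/

/-- **(E5.4) THE `T₁`-RECURSION FOR THE `η̂₁ c_μ`**: for antitone `μ : Fin 3 → ℤ`,
`Σ_{i : μ + e_i antitone} N₁(μ, μ + e_i) • η̂₁ c_{μ + e_i} = η̂₁ c_μ · (√Q • φ′₁ + √Q • 1)` in `ℋ(U(J₀,2)(E_w), K₀)` — the `η̂₁`-image of ★ (H.1)
`doubleCosetOperator_zpowDiagGL_mul_heckeDiag_one_three_of_antitone` (`c_μ · T₁ = Σ N₁ • c_{μ + e_i}`, orbit-count coefficients verbatim at `k = ℂ`), by (E5.3).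
[cite: Macdonald1995, Ch. II (4.6); Ch. V (2.6)] [cite: Rogawski1990, §4.10 Prop. 4.10.1 (b) p. 58] -/
theorem sum_pieri_one_smul_etaOneGraphPartnerAlgHom {ϖ' : w.1.adicCompletion E}
    (hd : UnramifiedLocalConjDatum (galAdicCompletionMap (L := E) c hw) ϖ')
    (t : unitaryGroupOfForm (galAdicCompletionMap (L := E) c hw) ((StdForm.antidiagonal 2).over (w.1.adicCompletion E)))
    (ht : (t : GL (Fin 2) (w.1.adicCompletion E)) = zpowDiagGL (uniformizer_ne_zero hd.vϖ) ![(1 : ℤ), -1])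
    (hqQ : ((Nat.card 𝓀[K] : ℕ) : ℂ) = (Nat.card (Valued.ResidueField (w.1.adicCompletion E)) : ℂ))
    {μ : Fin 3 → ℤ} (hμ : Antitone μ) :
    haveI := isHeckeTriple_unitaryInt_adicCompletion c v w hw ((StdForm.antidiagonal 2).over (w.1.adicCompletion E))
    ∑ i ∈ Finset.univ.filter (fun i : Fin 3 => Antitone (μ + Pi.single i 1)),
        (({γ ∈ MulAction.orbit (glInt 3 K) ((heckeDiag 3 (Units.mk0 ϖ hϖ.ne_zero) 1 : GL (Fin 3) K) : GL (Fin 3) K ⧸ glInt 3 K) |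
            ((γ.out⁻¹ * zpowDiagGL hϖ.ne_zero (μ + Pi.single i 1) : GL (Fin 3) K) : GL (Fin 3) K ⧸ glInt 3 K) ∈
              MulAction.orbit (glInt 3 K) ((zpowDiagGL hϖ.ne_zero μ : GL (Fin 3) K) : _ ⧸ _)}).ncard : ℂ) •
          etaOneGraphPartnerAlgHom c hc1 v w hw hv hϖ hu hwt
            (heckeAlgebra.doubleCosetOperator (glInt 3 K) (zpowDiagGL hϖ.ne_zero (μ + Pi.single i 1))) =
      etaOneGraphPartnerAlgHom c hc1 v w hw hv hϖ hu hwt (heckeAlgebra.doubleCosetOperator (glInt 3 K) (zpowDiagGL hϖ.ne_zero μ)) *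
        (((Nat.sqrt (Nat.card (Valued.ResidueField (w.1.adicCompletion E))) : ℕ) : ℂ) •
            heckeAlgebra.doubleCosetOperator
              (unitaryInt (galAdicCompletionMap (L := E) c hw) ((StdForm.antidiagonal 2).over (w.1.adicCompletion E))) t +
          ((Nat.sqrt (Nat.card (Valued.ResidueField (w.1.adicCompletion E))) : ℕ) : ℂ) • 1) := by
  haveI := isHeckeTriple_unitaryInt_adicCompletion c v w hw ((StdForm.antidiagonal 2).over (w.1.adicCompletion E))
  have h := (congrArg (etaOneGraphPartnerAlgHom c hc1 v w hw hv hϖ hu hwt)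
    (doubleCosetOperator_zpowDiagGL_mul_heckeDiag_one_three_of_antitone (k := ℂ) hϖ hμ)).symm.trans
    (etaOneGraphPartnerAlgHom_mul_heckeDiag_one c hc1 v w hw hv hϖ hu hwt hd t ht hqQ _)
  -- (term-mode composition: a `rw … at h` would let `kabstract` try to unfold the `GL₃` operators against the sum pattern — heartbeat blow-up)
  exact ((algHom_apply_sum_smul_etaOne _ _ _ _).symm.trans h :)

/-- **(E5.4′) THE `T₂`-RECURSION FOR THE `η̂₁ c_μ`**: for antitone `μ : Fin 3 → ℤ`,
`Σ_{i : μ + 𝟙 − e_i antitone} N₂(μ, μ + 𝟙 − e_i) • η̂₁ c_{μ + 𝟙 − e_i} = η̂₁ c_μ · (√Q • φ′₁ + √Q • 1)` — the `η̂₁`-image of ★ (H.2)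
`doubleCosetOperator_zpowDiagGL_mul_heckeDiag_two_three_of_antitone`, by (E5.3′) (`η̂₁ T₂ = η̂₁ T₁`: the two `GL₃` recursions collapse to ONE multiplier on the `U(1,1)` side).
[cite: Macdonald1995, Ch. II (4.6); Ch. V (2.6)] [cite: Rogawski1990, §4.10 Prop. 4.10.1 (b) p. 58] -/
theorem sum_pieri_two_smul_etaOneGraphPartnerAlgHom {ϖ' : w.1.adicCompletion E}
    (hd : UnramifiedLocalConjDatum (galAdicCompletionMap (L := E) c hw) ϖ')
    (t : unitaryGroupOfForm (galAdicCompletionMap (L := E) c hw) ((StdForm.antidiagonal 2).over (w.1.adicCompletion E)))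
    (ht : (t : GL (Fin 2) (w.1.adicCompletion E)) = zpowDiagGL (uniformizer_ne_zero hd.vϖ) ![(1 : ℤ), -1])
    (hqQ : ((Nat.card 𝓀[K] : ℕ) : ℂ) = (Nat.card (Valued.ResidueField (w.1.adicCompletion E)) : ℂ))
    {μ : Fin 3 → ℤ} (hμ : Antitone μ) :
    haveI := isHeckeTriple_unitaryInt_adicCompletion c v w hw ((StdForm.antidiagonal 2).over (w.1.adicCompletion E))
    ∑ i ∈ Finset.univ.filter (fun i : Fin 3 => Antitone (μ + 1 - Pi.single i 1)),
        (({γ ∈ MulAction.orbit (glInt 3 K) ((heckeDiag 3 (Units.mk0 ϖ hϖ.ne_zero) 2 : GL (Fin 3) K) : GL (Fin 3) K ⧸ glInt 3 K) |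
            ((γ.out⁻¹ * zpowDiagGL hϖ.ne_zero (μ + 1 - Pi.single i 1) : GL (Fin 3) K) : GL (Fin 3) K ⧸ glInt 3 K) ∈
              MulAction.orbit (glInt 3 K) ((zpowDiagGL hϖ.ne_zero μ : GL (Fin 3) K) : _ ⧸ _)}).ncard : ℂ) •
          etaOneGraphPartnerAlgHom c hc1 v w hw hv hϖ hu hwt
            (heckeAlgebra.doubleCosetOperator (glInt 3 K) (zpowDiagGL hϖ.ne_zero (μ + 1 - Pi.single i 1))) =
      etaOneGraphPartnerAlgHom c hc1 v w hw hv hϖ hu hwt (heckeAlgebra.doubleCosetOperator (glInt 3 K) (zpowDiagGL hϖ.ne_zero μ)) *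
        (((Nat.sqrt (Nat.card (Valued.ResidueField (w.1.adicCompletion E))) : ℕ) : ℂ) •
            heckeAlgebra.doubleCosetOperator
              (unitaryInt (galAdicCompletionMap (L := E) c hw) ((StdForm.antidiagonal 2).over (w.1.adicCompletion E))) t +
          ((Nat.sqrt (Nat.card (Valued.ResidueField (w.1.adicCompletion E))) : ℕ) : ℂ) • 1) := by
  haveI := isHeckeTriple_unitaryInt_adicCompletion c v w hw ((StdForm.antidiagonal 2).over (w.1.adicCompletion E))
  have h := (congrArg (etaOneGraphPartnerAlgHom c hc1 v w hw hv hϖ hu hwt)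
    (doubleCosetOperator_zpowDiagGL_mul_heckeDiag_two_three_of_antitone (k := ℂ) hϖ hμ)).symm.trans
    (etaOneGraphPartnerAlgHom_mul_heckeDiag_two c hc1 v w hw hv hϖ hu hwt hd t ht hqQ _)
  -- (term-mode composition: a `rw … at h` would let `kabstract` try to unfold the `GL₃` operators against the sum pattern — heartbeat blow-up)
  exact ((algHom_apply_sum_smul_etaOne _ _ _ _).symm.trans h :)

end Partner

end Summit.HodgeConjecture.HodgeConjecture.R90.S6
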